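/-
Copyright: statement-level skeleton of a published paper (lit-balaban cell, Phase-2 proof seat p25, gen 18). No proof
claims beyond what the kernel checks below.
-/
import Literature.MathematicalPhysics.QuantumFieldTheory.BalabanImbrieJaffe1984to88.BIJ88WalkExpansionGeo311
import Literature.MathematicalPhysics.QuantumFieldTheory.BalabanImbrieJaffe1984to88.BIJ88WalkIdentity311
import Literature.MathematicalPhysics.QuantumFieldTheory.BalabanImbrieJaffe1984to88.BIJ88WalkActivityShape312

/-!
# `BalabanImbrieJaffe1984to88.BIJ88WalkSplitInstance311` — T. Bałaban, J. Imbrie, A. Jaffe, *Effective action and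
cluster properties of the abelian Higgs model*, Commun. Math. Phys. **114** (1988) 257–315 [BalabanImbrieJaffe1988],
§5.14 p. 310–311 [PDF 54–55], verbatim: *"Recall that C^{(k)}_Λ is the Dirichlet inverse to (5.13.2), and we define
C^{(k)}_{Λ,loc} by cutting off the kernel when the arguments are separated by O(r(e_k))."* … *"After each integration by
parts, we replace the covariance by C^{(k)}_{loc} or C^{(k)}_{loc}(u_{k+1}) and give a random walk expansion for the
difference. For each term, let X be the union of the cubes covering the X_{σ_i} and the regions from the random walk
expansion. A connected component of X is called complete if … a term from the random walk expansion occurs …"* —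
**THE PRINTED SPLIT AS AN INSTANCE OF THE LANE**: pieces `P := Option Ω`, the local piece `none ↦ C_loc` (no trigger,
no region) and the random-walk terms `some ω ↦ D_ω` (trigger, region `Rg ω`), `C_loc + Σ_ω D_ω = C = A⁻¹`.  The four
statements of the generation specialized to it: the identity (`expand_val_loc`), the connectedness of every block and
remainder component (`expand_geo_loc`: local contractions join ADJACENT cubes, a walk term joins the two cubes THROUGH
ITS REGION), and the printed currency of every term (`expand_shape_loc`: `B_ℓ` per local bracket, `θ^{#Rg ω}` per walk
term, `θ^{#vc m}` per vertex after its legs' brackets).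

statement-level skeleton of published theorems with citation tags; proofs where landed; nothing here is a claim
about the Yang–Mills mass gap

PDF held: `paper:balaban1988-cmp114-bij-abelian-higgs-effective-action` (journal page = PDF page + 256); p. 310–312 =
PDF 54–56 (`p0054.txt` L35–38, `p0055.txt` L1–38, `p0056.txt` L1–25 re-read this session, 2026-08-22).

CITATION HEADER (lean-in-tree rule).  lit-balaban cell (HOME `run/shared/lean/pub/lit-balaban/`), Phase 2, seat p25
gen 18; row **C2.Claim@312** of `HOME/lit-balaban-r16/ROWS-C2-part2.md` (owner r16, referee ref-5; head
`BIJ88Sect5StatementsPart4.Ineq312` untouched).  USED BY NAME, nothing restated: `BIJ88WalkRun311.run`,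
`BIJ88WalkExpansion311.expand`, `BIJ88WalkExpansionGeo311.{NondegT, expand_geo_init}`, `BIJ88WalkGeometry311.{Geo, cubes}`,
`BIJ88WalkIdentity311.{tval, expand_val_init}`, `BIJ88WalkActivityShape312.{shape, expand_shape_init}` (this seat and
generation), `BIJ88LabelledExpansion311.gintM`, `Literature.Probability.LatticeModels.IsRConnected`.

## What is proved (0 `sorry`, standard axioms, no new `Prop` facts; definitions with bodies: `covOf`, `trigOf`, `regOf`)

* §1 `covOf` / `trigOf` / `regOf` (the instance) with `sum_covOf` (`C_loc + Σ_ω D_ω = A⁻¹ ⇒ Σ_p Cov p = A⁻¹`),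
  `trigOf_none`, `trigOf_some`, `regOf_none`, `regOf_some`, `covOf_none`, `covOf_some`.
* §2 **`expand_val_loc`** (nothing is lost), (private) `isRConnected_pair` (two adjacent cubes), **`expand_geo_loc`** (every
  block / remainder component of a nondegenerate term is `R`-connected, from: `C_loc` contracts adjacent cubes only,
  a walk term's region joins the cubes it contracts, observables' and vertices' legs inside their connected cubes),
  **`expand_shape_loc`** (the weight of every term in the printed currency).
HONEST SCOPE: (a) `C_loc`, the walk terms `D_ω`, their regions `Rg ω` and all bounds are DATA with the displayed
hypotheses — the cut-off at `O(r(e_k))` and the random-walk expansion of refs. 3–5 are not constructed, and in finite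
volume the walk terms are assumed grouped into finitely many pieces; (b)–(e) as in the siblings: contraction-graph
components, per-term statements (no count of terms, no activity bound), no analytic factor, no `Ineq312` binder.  NOT
summit progress; NOT continuum; NOT Clay.  Imports `BIJ88WalkExpansionGeo311`, `BIJ88WalkIdentity311`,
`BIJ88WalkActivityShape312`; modifies nothing.
-/

noncomputable section

namespace Literature.MathematicalPhysics.QuantumFieldTheory.BalabanImbrieJaffe1984to88.BIJ88WalkSplitInstance311

open Classical Matrix Finset
open scoped BigOperators
open Literature.Probability.LatticeModels (IsRConnected)
open BIJ88VertexIbp311 (vexp)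
open BIJ88WickDerivatives305 (dlist)
open BIJ88LabelledExpansion311 (gintM)
open BIJ88WalkRun311 BIJ88WalkGeometry311 BIJ88WalkExpansion311 BIJ88WalkExpansionGeo311 BIJ88WalkIdentity311
  BIJ88WalkWeights312 BIJ88WalkActivityShape312

variable {S : Type} [Fintype S] {ι : Type} [Fintype ι] {κ : Type} [LinearOrder κ] {Ω : Type} [Fintype Ω]
  {β : Type} [DecidableEq β]

/-! ## §1  The instance: `none ↦ C_loc`, `some ω ↦` the walk term `D_ω` -/

/-- **The pieces of the printed split**: the local covariance `C_loc` and the terms `D_ω` of the random-walk expansion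
of `C − C_loc`. [cite: BalabanImbrieJaffe1988, §5.14 p.310–311] -/
def covOf (Cl : Matrix S S ℝ) (D : Ω → Matrix S S ℝ) : Option Ω → Matrix S S ℝ := fun p => p.elim Cl D

/-- **The trigger**: *"complete … if a term from the random walk expansion occurs"* — the walk terms trigger, `C_loc`
does not. [cite: BalabanImbrieJaffe1988, §5.14 p.311] -/
def trigOf : Option Ω → Bool := Option.isSome

/-- **The regions**: *"the regions from the random walk expansion"* for the walk terms, nothing for `C_loc`.
[cite: BalabanImbrieJaffe1988, §5.14 p.311] -/
def regOf (Rg : Ω → Finset β) : Option Ω → Finset β := fun p => p.elim ∅ Rg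

omit [Fintype S] [Fintype Ω] in
/-- `covOf` on the local piece. [cite: BalabanImbrieJaffe1988, §5.14 p.310] -/
@[simp] theorem covOf_none (Cl : Matrix S S ℝ) (D : Ω → Matrix S S ℝ) : covOf Cl D none = Cl := rfl

omit [Fintype S] [Fintype Ω] in
/-- `covOf` on a walk term. [cite: BalabanImbrieJaffe1988, §5.14 p.311] -/
@[simp] theorem covOf_some (Cl : Matrix S S ℝ) (D : Ω → Matrix S S ℝ) (ω : Ω) : covOf Cl D (some ω) = D ω := rfl

omit [Fintype Ω] in
/-- The local piece does not trigger. [cite: BalabanImbrieJaffe1988, §5.14 p.311] -/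
@[simp] theorem trigOf_none : trigOf (none : Option Ω) = false := rfl

omit [Fintype Ω] in
/-- A walk term triggers. [cite: BalabanImbrieJaffe1988, §5.14 p.311] -/
@[simp] theorem trigOf_some (ω : Ω) : trigOf (some ω) = true := rfl

omit [Fintype Ω] [DecidableEq β] in
/-- The local piece has no region. [cite: BalabanImbrieJaffe1988, §5.14 p.311] -/
@[simp] theorem regOf_none (Rg : Ω → Finset β) : regOf Rg none = ∅ := rfl

omit [Fintype Ω] [DecidableEq β] in
/-- A walk term has its walk region. [cite: BalabanImbrieJaffe1988, §5.14 p.311] -/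
@[simp] theorem regOf_some (Rg : Ω → Finset β) (ω : Ω) : regOf Rg (some ω) = Rg ω := rfl

/-- **`C_loc + Σ_ω D_ω = C` gives `Σ_p Cov p = C`** (the datum of the identity file). [cite: BalabanImbrieJaffe1988, §5.14 p.311] -/
theorem sum_covOf {A Cl : Matrix S S ℝ} {D : Ω → Matrix S S ℝ} (h : Cl + ∑ ω, D ω = A⁻¹) : ∑ p, covOf Cl D p = A⁻¹ := by
  rw [Fintype.sum_option]
  simpa [covOf] using h

omit [Fintype Ω] in
/-- A trigger-free piece is the local one; a triggering piece is a walk term (bookkeeping).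
[cite: BalabanImbrieJaffe1988, §5.14 p.311] -/
theorem trigOf_eq_false_iff (p : Option Ω) : trigOf p = false ↔ p = none := by
  cases p <;> simp [trigOf]

/-! ## §2  The four statements of the generation for the printed split -/

section Statements

variable (A Cl : Matrix S S ℝ) (D : Ω → Matrix S S ℝ) (f : S → ℝ) (c : ι → ℝ) (legs : ι → List (S → ℝ))
  (χ : (S → ℝ) → ℝ) (obs : κ → List (S → ℝ)) (M : ℕ)

omit [DecidableEq β] in
/-- **NOTHING IS LOST under `C = C_loc + Σ_ω D_ω`**: the Gaussian integral of the product of all observables' legs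
against `χe^{−V}dμ_{C,ℱ}` equals the sum over the terms of the expansion — every contraction through `C_loc` or through
a walk term, components completed by walk terms set aside — of coefficient × the integral of the remainder components'
legs against `(Π_{dirs}∂)χ·e^{−V}`. [cite: BalabanImbrieJaffe1988, §5.14 p.311–312] -/
theorem expand_val_loc (hA : A.PosDef) (hχ : ∀ Dl : List (S → ℝ), ContDiff ℝ 1 (dlist Dl χ))
    (h0 : ∀ Dl : List (S → ℝ), ∃ K, ∀ φ, ‖dlist Dl χ φ * vexp c legs φ‖ ≤ K) (hC : Cl + ∑ ω, D ω = A⁻¹)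
    (K : Finset κ) :
    gintM A f c legs χ ((K.val.map fun j => (obs j : Multiset (S → ℝ))).sum) []
      = ((expand (covOf Cl D) trigOf f c legs obs M 0 K).map (tval A f c legs χ [])).sum :=
  expand_val_init hA hχ h0 (sum_covOf hC) K

variable {A Cl D f c legs χ obs M}

omit [Fintype S] [Fintype ι] [LinearOrder κ] [Fintype Ω] in
/-- Two adjacent cubes (or one cube) form an `R`-connected set (bookkeeping). [folklore] -/
private theorem isRConnected_pair {R : β → β → Prop} (hR : ∀ x y, R x y → R y x) {x y : β} (h : x = y ∨ R x y) :
    IsRConnected R ({x, y} : Finset β) := by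
  refine ⟨⟨x, Finset.mem_insert_self _ _⟩, fun v hv w hw => ?_⟩
  have hx : x ∈ ({x, y} : Finset β) := Finset.mem_insert_self _ _
  have hy : y ∈ ({x, y} : Finset β) := Finset.mem_insert_of_mem (Finset.mem_singleton_self _)
  have hxy : Relation.ReflTransGen (fun a b => R a b ∧ a ∈ ({x, y} : Finset β) ∧ b ∈ ({x, y} : Finset β)) x y := by
    rcases h with rfl | h
    · exact Relation.ReflTransGen.refl
    · exact Relation.ReflTransGen.single ⟨h, hx, hy⟩
  have hyx : Relation.ReflTransGen (fun a b => R a b ∧ a ∈ ({x, y} : Finset β) ∧ b ∈ ({x, y} : Finset β)) y x := by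
    rcases h with rfl | h
    · exact Relation.ReflTransGen.refl
    · exact Relation.ReflTransGen.single ⟨hR _ _ h, hy, hx⟩
  simp only [Finset.mem_insert, Finset.mem_singleton] at hv hw
  rcases hv with rfl | rfl <;> rcases hw with rfl | rfl
  · exact Relation.ReflTransGen.refl
  · exact hxy
  · exact hyx
  · exact Relation.ReflTransGen.refl

/-- **EVERY BLOCK AND EVERY REMAINDER COMPONENT IS `R`-CONNECTED, for the printed split** (p. 311): if `C_loc`
contracts only legs in equal or adjacent cubes (*"cutting off the kernel when the arguments are separated by
O(r(e_k))"*) and moves a leg only if its cube exists, if every walk term `D_ω` with a nonzero bracket between two legs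
has a region `Rg ω` which together with the two legs' cubes is `R`-connected (the walk joins them; for a single leg:
together with that leg's cube), and if observables' legs lie in their connected covering cubes and vertices' legs in
their connected localizations, then every block `X_c` and every remainder component `X_r` of every nondegenerate term
of `expand (covOf Cl D) trigOf … 0 K` has an `R`-connected cube set `X` carrying all its pending legs.
[cite: BalabanImbrieJaffe1988, §5.14 p.311] -/
theorem expand_geo_loc {oc : κ → Finset β} {vc : ι → Finset β} {Rg : Ω → Finset β} {R : β → β → Prop}
    {lc : (S → ℝ) → β} (hR : ∀ x y, R x y → R y x)
    (hloc : ∀ u w, (Cl *ᵥ u) ⬝ᵥ w ≠ 0 → lc u = lc w ∨ R (lc u) (lc w))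
    (hwalk : ∀ ω u w, (D ω *ᵥ u) ⬝ᵥ w ≠ 0 → IsRConnected R (insert (lc u) (insert (lc w) (Rg ω))))
    (hwalk1 : ∀ ω u, D ω *ᵥ u ≠ 0 → IsRConnected R (insert (lc u) (Rg ω)))
    (hocc : ∀ j, IsRConnected R (oc j)) (hobs : ∀ j, ∀ w ∈ obs j, lc w ∈ oc j)
    (hvcc : ∀ m, IsRConnected R (vc m)) (hlegs : ∀ m, ∀ w ∈ legs m, lc w ∈ vc m) (K : Finset κ) :
    ∀ t ∈ expand (covOf Cl D) trigOf f c legs obs M 0 K, NondegT t →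
      (∀ g ∈ t.consts, Geo oc vc (regOf Rg) R lc g) ∧ ∀ g ∈ t.groups, Geo oc vc (regOf Rg) R lc g := by
  refine expand_geo_init (fun p u w hp => ?_) (fun p u hp => ?_) hocc hobs hvcc hlegs K
  · cases p with
    | none =>
      rw [regOf_none, covOf_none] at *
      have h := isRConnected_pair hR (hloc u w hp)
      rwa [show (insert (lc u) (insert (lc w) (∅ : Finset β))) = ({lc u, lc w} : Finset β) from rfl]
    | some ω =>
      rw [regOf_some, covOf_some] at *
      exact hwalk ω u w hp
  · cases p with
    | none =>
      rw [regOf_none, covOf_none] at *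
      exact ⟨⟨lc u, Finset.mem_insert_self _ _⟩, fun v hv w hw => by
        simp only [Finset.mem_insert, Finset.notMem_empty, or_false] at hv hw
        subst hv; subst hw; exact Relation.ReflTransGen.refl⟩
    | some ω =>
      rw [regOf_some, covOf_some] at *
      exact hwalk1 ω u hp

/-- **THE WEIGHT OF EVERY TERM IN THE PRINTED CURRENCY, for the printed split** (p. 312): with brackets of `C_loc`
bounded by `B_ℓ ≥ 1` on the direction set, brackets of the walk term `D_ω` bounded by `θ^{#Rg ω}`, couplings
`|c m| ≤ cV m` with `cV m · B_ℓ^{|legs m|} ≤ θ^{#vc m}`, `0 < θ ≤ 1`: every term `t` of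
`expand (covOf Cl D) trigOf … 0 K` has `|coef_t|·Π‖dirs_t‖ ≤ Π_{X ∈ blocks} shape X · Π_{X ∈ remainder components} shape X`,
`shape X = (Π_{j∈X.lab} B_ℓ^{|obs j|}) · θ^{#(cubes X ∖ obs cubes)}`. [cite: BalabanImbrieJaffe1988, §5.14 p.312] -/
theorem expand_shape_loc {Dir : Set (S → ℝ)} {oc : κ → Finset β} {vc : ι → Finset β} {Rg : Ω → Finset β}
    {cV : ι → ℝ} {Bl θ : ℝ} (hθ0 : 0 < θ) (hθ1 : θ ≤ 1) (hBl : 1 ≤ Bl) (hcV0 : ∀ m, 0 ≤ cV m)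
    (hBl2 : ∀ u ∈ Dir, ∀ w ∈ Dir, |(Cl *ᵥ u) ⬝ᵥ w| ≤ Bl) (hBlf : ∀ u ∈ Dir, |(Cl *ᵥ u) ⬝ᵥ f| ≤ Bl)
    (hBlz : ∀ u ∈ Dir, ‖Cl *ᵥ u‖ ≤ Bl)
    (hW2 : ∀ ω, ∀ u ∈ Dir, ∀ w ∈ Dir, |(D ω *ᵥ u) ⬝ᵥ w| ≤ θ ^ (Rg ω).card)
    (hWf : ∀ ω, ∀ u ∈ Dir, |(D ω *ᵥ u) ⬝ᵥ f| ≤ θ ^ (Rg ω).card) (hWz : ∀ ω, ∀ u ∈ Dir, ‖D ω *ᵥ u‖ ≤ θ ^ (Rg ω).card)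
    (hcV : ∀ m, |c m| ≤ cV m) (hobs : ∀ j, ∀ w ∈ obs j, w ∈ Dir) (hlegs : ∀ m, ∀ w ∈ legs m, w ∈ Dir)
    (hvert : ∀ m, cV m * Bl ^ (legs m).length ≤ θ ^ (vc m).card) (K : Finset κ) :
    ∀ t ∈ expand (covOf Cl D) trigOf f c legs obs M 0 K,
      |t.coef| * (t.dirs.map fun z => ‖z‖).prod
        ≤ (t.consts.map (shape obs oc vc (regOf Rg) Bl θ)).prod * (t.groups.map (shape obs oc vc (regOf Rg) Bl θ)).prod := by
  -- the bracket bound of a piece: `B_ℓ` for `C_loc`, `θ^{#Rg ω}` for the walk term `ω`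
  let B : Option Ω → ℝ := fun p => p.elim Bl fun ω => θ ^ (Rg ω).card
  have hB0 : ∀ p, 0 ≤ B p := fun p => by
    cases p with
    | none => exact zero_le_one.trans hBl
    | some ω => exact pow_nonneg hθ0.le _
  refine expand_shape_init (B := B) hθ0 hθ1 hBl hB0 hcV0 (fun p u hu w hw => ?_) (fun p u hu => ?_) (fun p u hu => ?_)
    hcV hobs hlegs (fun p hp => ?_) (fun p hp => ?_) hvert K
  · cases p with
    | none => exact hBl2 u hu w hw
    | some ω => exact hW2 ω u hu w hw
  · cases p with
    | none => exact hBlf u hu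
    | some ω => exact hWf ω u hu
  · cases p with
    | none => exact hBlz u hu
    | some ω => exact hWz ω u hu
  · rw [trigOf_eq_false_iff] at hp
    subst hp
    exact ⟨le_rfl, rfl⟩
  · cases p with
    | none => exact absurd hp (by simp)
    | some ω => exact le_rfl

end Statements

end Literature.MathematicalPhysics.QuantumFieldTheory.BalabanImbrieJaffe1984to88.BIJ88WalkSplitInstance311

end
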